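import Literature.MathematicalPhysics.QuantumLattice.HubbardFermiCurve
import Mathlib.Topology.MetricSpace.Pseudo.Lemmas
import HarnessLib

/-!
# The Fermi radius `u(θ)` of the square-lattice dispersion: a continuous, symmetric closed curve

Topic `Literature/MathematicalPhysics/QuantumLattice`; continues `HubbardFermiCurve.lean`.
Benfatto–Giuliani–Mastropietro 2006, §1 ((1.4)–(1.5)): "if `0 < μ < 2`, then `Σ_F^{(0)}` is a smooth
convex closed curve, symmetric around the point `k⃗ = (0,0)`.  It can be parameterized as
`k⃗ = p⃗_F^{(0)}(θ)` in terms of the polar angle `θ ∈ [0, 2π]`.  We shall also denote `|p⃗_F^{(0)}(θ)|`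
by `u^{(0)}(θ)`."  In the tree's convention (`ε(k) = -2(cos k₁ + cos k₂)`, BGM's range
`-4 < μ < -2 - √2`) this file constructs the polar parametrisation and proves everything except
smoothness:

* `dir θ = (cos θ, sin θ)`; `sqDispersion_smul_dir_strictMonoOn` — `t ↦ ε(t·dir θ)` is strictly
  increasing on `[0, π/2]` (convexity of `ε` on `[-π/2, π/2]²` and `ε > -4` off the origin);
* `fermiRadius μ θ` — the Fermi radius `u(θ)`: for `-4 < μ < -2 - √2` it is the unique
  `t ∈ [0, π/2]` with `ε(t·dir θ) = μ` (`sqDispersion_fermiRadius`, `fermiRadius_unique`), and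
  `0 < u(θ) < π/4 · √2` (indeed `u(θ)·dir θ` lies in the box `|kᵢ| < π/4`);
* `continuous_fermiRadius` — **`u` is continuous** (so `Σ_F = {u(θ) dir θ}` is a closed continuous
  curve, star-shaped around `0` by `HubbardFermiCurve.sqDispersion_smul_lt`);
* `fermiRadius_add_pi`, `fermiRadius_neg`, `fermiRadius_pi_div_two_sub` — the symmetries of the
  Fermi curve (inversion `k ↦ -k`, reflection `k₂ ↦ -k₂`, exchange `k₁ ↔ k₂`).

Everything is proved; no named fact. [folklore]

## Sources

G. Benfatto, A. Giuliani, V. Mastropietro, Ann. Henri Poincaré 7 (2006), §1 (1.4)–(1.5)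
(`BenfattoGiulianiMastropietro2006`).
-/

noncomputable section

open Real Set Filter
open scoped Topology

namespace Literature.MathematicalPhysics.QuantumLattice

/-! ### Directions and the dispersion along a ray -/

/-- The unit vector of polar angle `θ`. [folklore] -/
def dir (θ : ℝ) : Fin 2 → ℝ := ![Real.cos θ, Real.sin θ]

/-- First component of `dir`. [folklore] -/
@[simp] theorem dir_zero (θ : ℝ) : dir θ 0 = Real.cos θ := rfl
/-- Second component of `dir`. [folklore] -/
@[simp] theorem dir_one (θ : ℝ) : dir θ 1 = Real.sin θ := rfl

/-- `|dir θ ᵢ| ≤ 1`. [folklore] -/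
theorem abs_dir_le_one (θ : ℝ) (i : Fin 2) : |dir θ i| ≤ 1 := by
  fin_cases i
  · exact Real.abs_cos_le_one θ
  · exact Real.abs_sin_le_one θ

/-- `dir θ ≠ 0`. [folklore] -/
theorem dir_ne_zero (θ : ℝ) : dir θ ≠ 0 := by
  intro h
  have h0 : Real.cos θ = 0 := by simpa using congrFun h 0
  have h1 : Real.sin θ = 0 := by simpa using congrFun h 1
  have := Real.sin_sq_add_cos_sq θ
  rw [h0, h1] at this
  norm_num at this

/-- `ε(k) = -4` only at the origin of `[-π/2, π/2]²` (indeed of `(-2π, 2π)²`): off the origin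
`ε > -4`. [folklore] -/
theorem neg_four_lt_sqDispersion {k : Fin 2 → ℝ} (hk : ∀ i, |k i| ≤ π / 2) (hk0 : k ≠ 0) :
    -4 < sqDispersion k := by
  have hcos : ∀ i, Real.cos (k i) ≤ 1 := fun i => Real.cos_le_one _
  -- some coordinate is nonzero, and there `cos < 1`
  obtain ⟨i, hi⟩ : ∃ i, k i ≠ 0 := by
    by_contra h
    exact hk0 (funext fun i => not_not.1 (not_exists.1 h i))
  have hlt : Real.cos (k i) < 1 := by
    rw [← Real.cos_abs]
    have h1 : 0 < |k i| := abs_pos.2 hi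
    have h2 : |k i| ≤ π / 2 := hk i
    have := Real.cos_lt_cos_of_nonneg_of_le_pi_div_two le_rfl h2 h1
    rwa [Real.cos_zero] at this
  unfold sqDispersion
  fin_cases i
  · have := hcos 1; change Real.cos (k 0) < 1 at hlt; linarith
  · have := hcos 0; change Real.cos (k 1) < 1 at hlt; linarith

/-- `t · dir θ ∈ [-π/2, π/2]²` for `0 ≤ t ≤ π/2`. [folklore] -/
theorem smul_dir_mem_halfBox (θ : ℝ) {t : ℝ} (ht0 : 0 ≤ t) (ht : t ≤ π / 2) : t • dir θ ∈ halfBox :=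
  mem_halfBox.2 fun i => by
    have h : |t * dir θ i| ≤ π / 2 := by
      rw [abs_mul, abs_of_nonneg ht0]
      exact (mul_le_mul ht (abs_dir_le_one θ i) (abs_nonneg _) (by positivity)).trans (by rw [mul_one])
    rw [Pi.smul_apply, smul_eq_mul]
    exact ⟨(abs_le.1 h).1, (abs_le.1 h).2⟩

/-- **`t ↦ ε(t · dir θ)` is strictly increasing on `[0, π/2]`.** [folklore] -/
theorem sqDispersion_smul_dir_strictMonoOn (θ : ℝ) :
    StrictMonoOn (fun t : ℝ => sqDispersion (t • dir θ)) (Icc 0 (π / 2)) := by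
  intro s hs t ht hst
  have htpos : 0 < t := hs.1.trans_lt hst
  -- convexity between `0` and `t • dir θ`
  have hk : t • dir θ ∈ halfBox := smul_dir_mem_halfBox θ ht.1 ht.2
  have hconv := strictConvexOn_sqDispersion.convexOn.2 zero_mem_halfBox hk
    (by have := div_le_one_of_le₀ hst.le htpos.le; linarith : 0 ≤ 1 - s / t) (div_nonneg hs.1 htpos.le) (by ring)
  rw [smul_zero, zero_add, sqDispersion_zero, smul_smul, div_mul_cancel₀ _ htpos.ne', smul_eq_mul, smul_eq_mul] at hconv
  -- `ε(t • dir θ) > -4` since `t • dir θ ≠ 0`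
  have hne : t • dir θ ≠ 0 := smul_ne_zero htpos.ne' (dir_ne_zero θ)
  have hgt : -4 < sqDispersion (t • dir θ) :=
    neg_four_lt_sqDispersion (fun i => abs_le.2 ⟨(mem_halfBox.1 hk i).1, (mem_halfBox.1 hk i).2⟩) hne
  have hlt1 : s / t < 1 := (div_lt_one htpos).2 hst
  show sqDispersion (s • dir θ) < sqDispersion (t • dir θ)
  nlinarith

/-- `ε(t · dir θ)` is continuous in `(θ, t)`; in particular in each variable. [folklore] -/
theorem continuous_sqDispersion_smul_dir : Continuous fun p : ℝ × ℝ => sqDispersion (p.2 • dir p.1) := by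
  have h : (fun p : ℝ × ℝ => sqDispersion (p.2 • dir p.1)) =
      fun p => -2 * (Real.cos (p.2 * Real.cos p.1) + Real.cos (p.2 * Real.sin p.1)) := by
    funext p; simp [sqDispersion, dir]
  rw [h]
  fun_prop

/-! ### The Fermi radius -/

/-- From `x² ≥ 1/2` conclude `1/2 ≤ |x|`. [folklore] -/
theorem half_le_abs_of_sq {x : ℝ} (hx : 1 / 2 ≤ x ^ 2) : 1 / 2 ≤ |x| := by
  by_contra h
  have h : |x| < 1 / 2 := lt_of_not_ge h
  have h' : |x| ^ 2 < (1 / 2) ^ 2 := by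
    have := abs_nonneg x
    nlinarith
  rw [sq_abs] at h'
  linarith

/-- **Exit radius**: along every ray there is `0 < T ≤ π/2` with `ε(T · dir θ) > μ`
(for `μ < -2 - √2`: the point where the ray leaves the box `|kᵢ| ≤ π/4`). [folklore] -/
theorem exists_exit (θ : ℝ) {μ : ℝ} (hμ : μ < -2 - Real.sqrt 2) :
    ∃ T : ℝ, 0 < T ∧ T ≤ π / 2 ∧ μ < sqDispersion (T • dir θ) := by
  have hπ := Real.pi_pos
  have h1 := Real.sin_sq_add_cos_sq θ
  rcases le_total |Real.sin θ| |Real.cos θ| with h | h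
  · -- `|cos θ| ≥ 1/2`; exit through the `k₁`-faces
    have hsq : 1 / 2 ≤ Real.cos θ ^ 2 := by
      have := sq_le_sq' (by linarith [abs_nonneg (Real.sin θ), neg_abs_le (Real.sin θ)] : -|Real.cos θ| ≤ Real.sin θ)
        ((le_abs_self _).trans h)
      rw [sq_abs] at this
      nlinarith
    have hc : 1 / 2 ≤ |Real.cos θ| := half_le_abs_of_sq hsq
    have hcpos : 0 < |Real.cos θ| := by linarith
    refine ⟨π / 4 / |Real.cos θ|, by positivity, ?_, lt_sqDispersion_of_exists_abs_eq hμ ⟨0, ?_⟩⟩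
    · rw [div_le_iff₀ hcpos]; nlinarith
    · rw [Pi.smul_apply, smul_eq_mul, dir_zero, abs_mul, abs_of_pos (by positivity), div_mul_cancel₀ _ hcpos.ne']
  · -- `|sin θ| ≥ 1/2`; exit through the `k₂`-faces
    have hsq : 1 / 2 ≤ Real.sin θ ^ 2 := by
      have := sq_le_sq' (by linarith [abs_nonneg (Real.cos θ), neg_abs_le (Real.cos θ)] : -|Real.sin θ| ≤ Real.cos θ)
        ((le_abs_self _).trans h)
      rw [sq_abs] at this
      nlinarith
    have hc : 1 / 2 ≤ |Real.sin θ| := half_le_abs_of_sq hsq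
    have hcpos : 0 < |Real.sin θ| := by linarith
    refine ⟨π / 4 / |Real.sin θ|, by positivity, ?_, lt_sqDispersion_of_exists_abs_eq hμ ⟨1, ?_⟩⟩
    · rw [div_le_iff₀ hcpos]; nlinarith
    · rw [Pi.smul_apply, smul_eq_mul, dir_one, abs_mul, abs_of_pos (by positivity), div_mul_cancel₀ _ hcpos.ne']

/-- The defining property of the Fermi radius along the ray of angle `θ`. [folklore] -/
def IsFermiRadius (μ θ t : ℝ) : Prop := (0 ≤ t ∧ t ≤ π / 2) ∧ sqDispersion (t • dir θ) = μ

/-- **Existence and uniqueness of the Fermi radius** on `[0, π/2]` along every ray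
(`-4 < μ < -2 - √2`). [folklore] -/
theorem existsUnique_isFermiRadius {μ : ℝ} (hμ₁ : -4 < μ) (hμ₂ : μ < -2 - Real.sqrt 2) (θ : ℝ) :
    ∃! t, IsFermiRadius μ θ t := by
  obtain ⟨T, hT0, hTπ, hTμ⟩ := exists_exit θ hμ₂
  have hcont : ContinuousOn (fun t : ℝ => sqDispersion (t • dir θ)) (Icc 0 T) :=
    (continuous_sqDispersion_smul_dir.comp (Continuous.prodMk_right θ)).continuousOn
  have h0 : sqDispersion ((0 : ℝ) • dir θ) < μ := by rw [zero_smul, sqDispersion_zero]; exact hμ₁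
  obtain ⟨t, ht, hte⟩ : ∃ t ∈ Ioo 0 T, sqDispersion (t • dir θ) = μ :=
    intermediate_value_Ioo hT0.le hcont ⟨h0, hTμ⟩
  refine ⟨t, ⟨⟨ht.1.le, ht.2.le.trans hTπ⟩, hte⟩, ?_⟩
  rintro s ⟨⟨hs0, hsπ⟩, hse⟩
  have hmono := sqDispersion_smul_dir_strictMonoOn θ
  exact hmono.injOn ⟨hs0, hsπ⟩ ⟨ht.1.le, ht.2.le.trans hTπ⟩ (hse.trans hte.symm)

/-- **The Fermi radius `u(θ)`** of the level `μ` along the ray of angle `θ` (the polar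
parametrisation `p⃗_F(θ) = u(θ)(cos θ, sin θ)` of Benfatto–Giuliani–Mastropietro 2006, (1.5));
Hilbert's `ε` of the defining property (unspecified junk when there is no root in `[0, π/2]`). [folklore] -/
def fermiRadius (μ θ : ℝ) : ℝ :=
  Classical.epsilon (IsFermiRadius μ θ)

section Range

variable {μ : ℝ} (hμ₁ : -4 < μ) (hμ₂ : μ < -2 - Real.sqrt 2)
include hμ₁ hμ₂

/-- The Fermi radius has the defining property. [folklore] -/
theorem isFermiRadius_fermiRadius (θ : ℝ) : IsFermiRadius μ θ (fermiRadius μ θ) := by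
  have h : ∃ t, IsFermiRadius μ θ t := (existsUnique_isFermiRadius hμ₁ hμ₂ θ).exists
  exact Classical.epsilon_spec h

/-- **`ε(u(θ) · dir θ) = μ`**: the curve `θ ↦ u(θ) dir θ` lies on the Fermi curve. [folklore] -/
theorem sqDispersion_fermiRadius (θ : ℝ) : sqDispersion (fermiRadius μ θ • dir θ) = μ :=
  (isFermiRadius_fermiRadius hμ₁ hμ₂ θ).2

/-- Uniqueness: any root in `[0, π/2]` is the Fermi radius. [folklore] -/
theorem fermiRadius_unique {θ t : ℝ} (ht : IsFermiRadius μ θ t) : t = fermiRadius μ θ :=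
  (existsUnique_isFermiRadius hμ₁ hμ₂ θ).unique ht (isFermiRadius_fermiRadius hμ₁ hμ₂ θ)

/-- `0 < u(θ)`. [folklore] -/
theorem fermiRadius_pos (θ : ℝ) : 0 < fermiRadius μ θ := by
  rcases (isFermiRadius_fermiRadius hμ₁ hμ₂ θ).1.1.eq_or_lt with h | h
  · have := sqDispersion_fermiRadius hμ₁ hμ₂ θ
    rw [← h, zero_smul, sqDispersion_zero] at this
    linarith
  · exact h

/-- `u(θ) ≤ π/2`. [folklore] -/
theorem fermiRadius_le (θ : ℝ) : fermiRadius μ θ ≤ π / 2 := (isFermiRadius_fermiRadius hμ₁ hμ₂ θ).1.2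

/-- The Fermi curve lies in the open box `|kᵢ| < π/4` (cf. `HubbardFermiCurve`). [folklore] -/
theorem abs_fermiRadius_mul_dir_lt (θ : ℝ) (i : Fin 2) : |fermiRadius μ θ * dir θ i| < π / 4 := by
  have h := abs_lt_pi_div_four_of_sqDispersion_eq hμ₂ (k := fermiRadius μ θ • dir θ) (fun j => ?_)
    (sqDispersion_fermiRadius hμ₁ hμ₂ θ) i
  · simpa using h
  · have hm := mem_halfBox.1 (smul_dir_mem_halfBox θ (fermiRadius_pos hμ₁ hμ₂ θ).le (fermiRadius_le hμ₁ hμ₂ θ)) j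
    exact abs_le.2 ⟨by linarith [hm.1, Real.pi_pos], by linarith [hm.2, Real.pi_pos]⟩

/-- `u(θ) < π/2` (strictly inside the monotonicity interval). [folklore] -/
theorem fermiRadius_lt (θ : ℝ) : fermiRadius μ θ < π / 2 := by
  obtain ⟨T, hT0, hTπ, hTμ⟩ := exists_exit θ hμ₂
  have hmono := sqDispersion_smul_dir_strictMonoOn θ
  have hu := isFermiRadius_fermiRadius hμ₁ hμ₂ θ
  have hlt : fermiRadius μ θ < T := by
    by_contra h
    have h : T ≤ fermiRadius μ θ := le_of_not_gt h
    have := hmono.monotoneOn ⟨hT0.le, hTπ⟩ hu.1 h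
    rw [hu.2] at this
    exact absurd hTμ (not_lt.2 this)
  exact hlt.trans_le hTπ

/-! ### Continuity -/

/-- **The Fermi radius is continuous** in the angle. [cite: BenfattoGiulianiMastropietro2006, §1 (1.4)-(1.5)] -/
theorem continuous_fermiRadius : Continuous (fermiRadius μ) := by
  refine Metric.continuous_iff.2 fun θ ε hε => ?_
  set t₀ := fermiRadius μ θ with ht₀
  have ht₀pos : 0 < t₀ := fermiRadius_pos hμ₁ hμ₂ θ
  have ht₀lt : t₀ < π / 2 := fermiRadius_lt hμ₁ hμ₂ θ
  -- a margin `ε' ≤ ε` keeping `t₀ ± ε'` inside `(0, π/2)`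
  set ε' := min ε (min t₀ (π / 2 - t₀)) / 2 with hε'
  have hε'pos : 0 < ε' := by
    have : 0 < min ε (min t₀ (π / 2 - t₀)) := lt_min hε (lt_min ht₀pos (by linarith))
    positivity
  have hε'le : ε' < ε := by
    have : min ε (min t₀ (π / 2 - t₀)) ≤ ε := min_le_left _ _
    linarith
  have hlo : 0 < t₀ - ε' := by
    have : min ε (min t₀ (π / 2 - t₀)) ≤ t₀ := (min_le_right _ _).trans (min_le_left _ _)
    linarith
  have hhi : t₀ + ε' < π / 2 := by
    have : min ε (min t₀ (π / 2 - t₀)) ≤ π / 2 - t₀ := (min_le_right _ _).trans (min_le_right _ _)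
    linarith
  have hmono := sqDispersion_smul_dir_strictMonoOn θ
  have hmemlo : t₀ - ε' ∈ Icc 0 (π / 2) := ⟨hlo.le, by linarith⟩
  have hmemhi : t₀ + ε' ∈ Icc 0 (π / 2) := ⟨by linarith, hhi.le⟩
  have hmem0 : t₀ ∈ Icc 0 (π / 2) := ⟨ht₀pos.le, ht₀lt.le⟩
  have hbelow : sqDispersion ((t₀ - ε') • dir θ) < μ := by
    have h := hmono hmemlo hmem0 (by linarith)
    simp only at h
    rwa [sqDispersion_fermiRadius hμ₁ hμ₂ θ] at h
  have habove : μ < sqDispersion ((t₀ + ε') • dir θ) := by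
    have h := hmono hmem0 hmemhi (by linarith)
    simp only at h
    rwa [sqDispersion_fermiRadius hμ₁ hμ₂ θ] at h
  -- by joint continuity both strict inequalities persist for nearby angles
  have hc : ∀ t : ℝ, ContinuousAt (fun θ' : ℝ => sqDispersion (t • dir θ')) θ := fun t =>
    (continuous_sqDispersion_smul_dir.comp (Continuous.prodMk_left t)).continuousAt
  have hev : ∀ᶠ θ' in 𝓝 θ, sqDispersion ((t₀ - ε') • dir θ') < μ ∧ μ < sqDispersion ((t₀ + ε') • dir θ') :=
    ((hc (t₀ - ε')).eventually (gt_mem_nhds hbelow)).and ((hc (t₀ + ε')).eventually (lt_mem_nhds habove))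
  obtain ⟨δ, hδ, hball⟩ := Metric.eventually_nhds_iff.1 hev
  refine ⟨δ, hδ, fun θ' hθ' => ?_⟩
  obtain ⟨h1, h2⟩ := hball hθ'
  -- the root at `θ'` is squeezed between `t₀ - ε'` and `t₀ + ε'`
  have hu' := isFermiRadius_fermiRadius hμ₁ hμ₂ θ'
  have hmono' := sqDispersion_smul_dir_strictMonoOn θ'
  have hgt : t₀ - ε' < fermiRadius μ θ' := by
    by_contra h
    have h : fermiRadius μ θ' ≤ t₀ - ε' := le_of_not_gt h
    have := hmono'.monotoneOn hu'.1 hmemlo h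
    rw [hu'.2] at this
    exact absurd h1 (not_lt.2 this)
  have hlt' : fermiRadius μ θ' < t₀ + ε' := by
    by_contra h
    have h : t₀ + ε' ≤ fermiRadius μ θ' := le_of_not_gt h
    have := hmono'.monotoneOn hmemhi hu'.1 h
    rw [hu'.2] at this
    exact absurd h2 (not_lt.2 this)
  rw [Real.dist_eq, abs_lt]
  constructor <;> linarith

/-! ### Symmetries -/

/-- A root along a ray whose dispersion values agree with those of another ray is the Fermi
radius of the latter. [folklore] -/
theorem fermiRadius_eq_of_forall_eq {θ θ' : ℝ} (h : ∀ t : ℝ, sqDispersion (t • dir θ') = sqDispersion (t • dir θ)) :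
    fermiRadius μ θ' = fermiRadius μ θ := by
  refine fermiRadius_unique hμ₁ hμ₂ ⟨(isFermiRadius_fermiRadius hμ₁ hμ₂ θ').1, ?_⟩
  rw [← h, sqDispersion_fermiRadius hμ₁ hμ₂ θ']

/-- **Inversion symmetry**: `u(θ + π) = u(θ)` (`ε(-k) = ε(k)`). [folklore] -/
theorem fermiRadius_add_pi (θ : ℝ) : fermiRadius μ (θ + π) = fermiRadius μ θ :=
  fermiRadius_eq_of_forall_eq hμ₁ hμ₂ fun t => by
    simp [sqDispersion, dir, Real.cos_add_pi, Real.sin_add_pi, Real.cos_neg]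

/-- **Reflection symmetry**: `u(-θ) = u(θ)` (`ε(k₁, -k₂) = ε(k)`). [folklore] -/
theorem fermiRadius_neg (θ : ℝ) : fermiRadius μ (-θ) = fermiRadius μ θ :=
  fermiRadius_eq_of_forall_eq hμ₁ hμ₂ fun t => by
    simp [sqDispersion, dir, Real.cos_neg, Real.sin_neg]

/-- **Exchange symmetry**: `u(π/2 - θ) = u(θ)` (`ε(k₂, k₁) = ε(k)`). [folklore] -/
theorem fermiRadius_pi_div_two_sub (θ : ℝ) : fermiRadius μ (π / 2 - θ) = fermiRadius μ θ :=
  fermiRadius_eq_of_forall_eq hμ₁ hμ₂ fun t => by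
    simp [sqDispersion, dir, Real.cos_pi_div_two_sub, Real.sin_pi_div_two_sub, add_comm]

end Range

end Literature.MathematicalPhysics.QuantumLattice
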